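import Literature.MathematicalPhysics.QuantumFieldTheory.OSLocalityHolds
import Literature.MathematicalPhysics.QuantumLattice.TubeBoundaryValueLocal
import Literature.MathematicalPhysics.QuantumLattice.WightmanTubeLaplace
import Literature.Analysis.Distribution.RayBoundaryValueGrowth
import HarnessLib

/-!
# Locality (R3) of the Osterwalder–Schrader boundary values, unconditionally:
`OS1973_local_holds`

Topic `Literature/MathematicalPhysics/QuantumFieldTheory`; closes the named fact
`Literature.MathematicalPhysics.QuantumFieldTheory.OS1973_local` (conjunct (A₃, R3) of
`os_reconstruction`, `WightmanProofs`; Osterwalder–Schrader I (1973), §4.5 "Locality", p. 97).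

`OSLocalityHolds` reduced `OS1973_local` to the polynomial growth of the OS continuations `𝔚ₙ` at the
edge of the forward tube (`IsOSContinuationFamily.isLocalFamily_of_hasEdgeGrowth`: E1, E3, the
Bargmann–Hall–Wightman theorem and the local tube argument of `OSLocalTube`), and explained why the
fact as stated in the tree — for *every* OS continuation family, whose defining property
`HasDistributionalBoundaryValue` only provides **ray-wise** distributional boundary values — does not
follow from §4.5 alone: OS's own `𝔚ₙ` have the growth from their Fourier–Laplace representation
(4.12). This file supplies the missing analytic theorem in general and discharges the fact:

* `hasEdgeGrowth_of_hasDistributionalBoundaryValue` — **a function holomorphic on the forward tube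
  with ray-wise tempered distributional boundary values has polynomial growth at the edge, locally
  uniformly** (`HasEdgeGrowth`). This is the tree's
  `Literature.Analysis.Distribution.exists_norm_le_inv_pow_of_ray_bounded` (several-variable
  companion of Hörmander, *ALPDO I*, Thm. 3.1.14: Banach–Steinhaus on each ray, Baire over the
  directions, propagation to all directions by analytic discs, polydisc mean value) transported to
  point configurations (`cpxConfigCLM`, the measure-preserving coordinates `coordCLE`);
* `IsOSContinuationFamily.hasEdgeGrowth`-free corollary `IsOSContinuationFamily.isLocalFamily`: every
  OS continuation family of an OS family `S` (E1, E3 are used) is local;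
* `OS1973_local_holds : OS1973_local` — the discharge (the hypothesis E0' of the fact is not needed).

## References

* K. Osterwalder, R. Schrader, *Axioms for Euclidean Green's functions*, Comm. Math. Phys. 31 (1973)
  83–112, §4.5 p. 97 (locality from E3, Bargmann–Hall–Wightman, Jost's theorem). [OsterwalderSchraderCMP1973]
* L. Hörmander, *The Analysis of Linear Partial Differential Operators I*, Thms. 3.1.14–3.1.15. [HormanderALPDO1]
* R. F. Streater, A. S. Wightman, *PCT, Spin and Statistics, and All That* (1964), §3-3. [StreaterWightman1964]
-/

noncomputable section

open MeasureTheory Filter Complex Set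
open _root_.Topology
open scoped SchwartzMap ContDiff
open Literature.MathematicalPhysics.QuantumLattice Literature.MathematicalPhysics.QuantumFieldTheory
open Literature.Analysis.Distribution Literature.Analysis.FunctionSpaces

namespace Literature.MathematicalPhysics.QuantumFieldTheory

variable {d n : ℕ}

/-! ### Geometry of the base cone and coordinates -/

/-- The base cone `tubeCone d n` is convex (preimage of `V₊ × ⋯ × V₊` under the linear map of
successive differences). [folklore] -/
theorem convex_tubeCone : Convex ℝ (tubeCone d n) := by
  intro η hη η' hη' a b ha hb hab k
  have h := convex_forwardCone (d := d) (hη k) (hη' k) ha hb hab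
  simpa [succDiff_add, succDiff_smul] using h

/-- The base cone is closed under positive dilations (cone form used by the analytic theorems).
[folklore] -/
theorem smul_mem_tubeCone' (c : ℝ) (hc : 0 < c) (y : Fin n → SpaceTime d) (hy : y ∈ tubeCone d n) :
    c • y ∈ tubeCone d n :=
  smul_mem_tubeCone hy hc

/-- The tube point `x + i y` in the `J`-notation of the analytic theorems is the configuration
`(x_k + i y_k)_k`. [folklore] -/
theorem cpxConfigCLM_add_I_smul (x y : Fin n → SpaceTime d) (t : ℝ) :
    cpxConfigCLM d n x + ((t : ℂ) * I) • cpxConfigCLM d n y =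
      fun k => complexifyPoint (x k) + ((t : ℂ) * I) • complexifyPoint (y k) := by
  funext k
  simp [cpxConfigCLM_apply]

/-- Tube points over the base cone lie in the forward tube. [folklore] -/
theorem cpxConfigCLM_add_I_smul_mem_forwardTube (x y : Fin n → SpaceTime d) (hy : y ∈ tubeCone d n) :
    cpxConfigCLM d n x + (I : ℂ) • cpxConfigCLM d n y ∈ forwardTube d n := by
  have h := mem_forwardTube_of_mem_tubeCone x y hy one_pos
  rw [← cpxConfigCLM_add_I_smul] at h
  simpa using h

variable (d n) in
/-- **Measure-preserving linear coordinates** `ℝ^{n(d+1)} ≃ (ℝ^{1+d})ⁿ`: reindexing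
`Fin (n(d+1)) ≃ Fin n × Fin (d+1)`, the Euclidean `WithLp` identification, and the inverse of the
tree's flattening `flattenCLE`. [folklore] -/
def coordCLE : (Fin (n * (d + 1)) → ℝ) ≃L[ℝ] (Fin n → SpaceTime d) :=
  ((ContinuousLinearEquiv.piCongrLeft ℝ (fun _ : Fin n × Fin (d + 1) => ℝ)
      finProdFinEquiv.symm).trans (EuclideanSpace.equiv (Fin n × Fin (d + 1)) ℝ).symm).trans
    (flattenCLE d n).symm

/-- `coordCLE` preserves Lebesgue measure. [folklore] -/
theorem measurePreserving_coordCLE : MeasurePreserving (coordCLE d n) volume volume := by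
  have h₁ : MeasurePreserving (MeasurableEquiv.piCongrLeft (fun _ : Fin n × Fin (d + 1) => ℝ)
      finProdFinEquiv.symm) volume volume :=
    volume_measurePreserving_piCongrLeft _ _
  have h₂ : MeasurePreserving (WithLp.toLp 2 : (Fin n × Fin (d + 1) → ℝ) →
      EuclideanSpace ℝ (Fin n × Fin (d + 1))) volume volume :=
    PiLp.volume_preserving_toLp (Fin n × Fin (d + 1))
  have h₃ : MeasurePreserving (flattenCLE d n).toHomeomorph.toMeasurableEquiv volume volume := by
    rw [Homeomorph.toMeasurableEquiv_coe, ContinuousLinearEquiv.coe_toHomeomorph]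
    exact measurePreserving_flattenCLE
  have h₃s : MeasurePreserving (flattenCLE d n).symm volume volume := by
    have h := h₃.symm _
    rwa [Homeomorph.toMeasurableEquiv_symm_coe, ContinuousLinearEquiv.coe_symm_toHomeomorph] at h
  have h := (h₃s.comp h₂).comp h₁
  have hfun : (⇑(coordCLE d n) : (Fin (n * (d + 1)) → ℝ) → (Fin n → SpaceTime d)) =
      (flattenCLE d n).symm ∘
        (WithLp.toLp 2 : (Fin n × Fin (d + 1) → ℝ) → EuclideanSpace ℝ (Fin n × Fin (d + 1))) ∘
          MeasurableEquiv.piCongrLeft (fun _ : Fin n × Fin (d + 1) => ℝ) finProdFinEquiv.symm := by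
    funext u
    simp only [coordCLE, ContinuousLinearEquiv.trans_apply, Function.comp_apply,
      MeasurableEquiv.coe_piCongrLeft, EuclideanSpace.equiv, PiLp.coe_symm_continuousLinearEquiv]
    rfl
  rw [hfun]
  exact h

/-! ### Edge growth from ray-wise boundary values -/

/-- **A function holomorphic on the forward tube with (ray-wise) tempered distributional boundary
values has polynomial growth at the edge, locally uniformly.** If `𝔚` is complex differentiable on
`𝒯ₙ` and `HasDistributionalBoundaryValue 𝔚 T` (for every direction `η` of the base cone and every
Schwartz `F`, `∫ 𝔚(x + itη) F(x) dx → T(F)` as `t → 0⁺`), then `HasEdgeGrowth 𝔚`: for every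
compact `K` of directions and radius `R`, `‖𝔚(x + itη)‖ ≤ C t^{-r}` for `‖x‖ ≤ R`, `η ∈ K`,
`0 < t < 1`. The convergence is only used, ray by ray and for compactly supported `F`, to bound
the pairings on `t ∈ (0, 1]`; the rest is the analytic theorem
`Literature.Analysis.Distribution.exists_norm_le_inv_pow_of_ray_bounded` (Banach–Steinhaus, Baire,
analytic discs, polydisc mean value), the several-variable companion of Hörmander's Thm. 3.1.14
(which is the one-variable case; no source prints the ray-wise several-variable statement). [folklore] -/
theorem hasEdgeGrowth_of_hasDistributionalBoundaryValue {𝔚 : (Fin n → Fin (d + 1) → ℂ) → ℂ}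
    {T : 𝓢((Fin n → SpaceTime d), ℂ) →L[ℂ] ℂ} (h𝔚 : DifferentiableOn ℂ 𝔚 (forwardTube d n))
    (hbv : HasDistributionalBoundaryValue 𝔚 T) : HasEdgeGrowth 𝔚 := by
  intro K hK hKΓ R
  have hΓcone : ∀ c : ℝ, 0 < c → ∀ y ∈ tubeCone d n, c • y ∈ tubeCone d n :=
    fun c hc y hy => smul_mem_tubeCone hy hc
  have htube : ∀ x : Fin n → SpaceTime d, ∀ y ∈ tubeCone d n,
      cpxConfigCLM d n x + (I : ℂ) • cpxConfigCLM d n y ∈ forwardTube d n :=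
    fun x y hy => cpxConfigCLM_add_I_smul_mem_forwardTube x y hy
  have hray : ∀ η ∈ tubeCone d n, ∀ φ : (Fin n → SpaceTime d) → ℂ, ContDiff ℝ ∞ φ →
      HasCompactSupport φ → ∃ C : ℝ, ∀ t ∈ Ioc (0 : ℝ) 1,
        ‖∫ x, 𝔚 (cpxConfigCLM d n x + ((t : ℂ) * I) • cpxConfigCLM d n η) * φ x‖ ≤ C := by
    intro η hη φ hφ hφc
    refine exists_ray_bound_of_tendsto (μ := volume) h𝔚.continuousOn isOpen_tubeCone hΓcone htube
      hη hφ hφc (l := T (hφc.toSchwartzMap hφ)) ?_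
    have h := hbv η hη (hφc.toSchwartzMap hφ)
    refine h.congr fun t => ?_
    simp_rw [cpxConfigCLM_add_I_smul]
    rfl
  have key := exists_norm_le_inv_pow_of_ray_bounded (V := Fin n → SpaceTime d)
    (E := Fin n → Fin (d + 1) → ℂ) (μ := volume) (J := cpxConfigCLM d n) (f := 𝔚) (U := forwardTube d n)
    (Γ := tubeCone d n) isOpen_forwardTube h𝔚 isOpen_tubeCone convex_tubeCone hΓcone htube
    (coordCLE d n) measurePreserving_coordCLE
  obtain ⟨C, r, hC⟩ := key hray hK hKΓ R
  refine ⟨C, r, fun x hx η hη t ht0 ht1 => ?_⟩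
  have h := hC x hx η hη t ht0 ht1
  rwa [cpxConfigCLM_add_I_smul] at h

/-! ### Locality of OS continuation families and the discharge of `OS1973_local` -/

/-- **Every OS continuation family is local.** For an OS family `S` (E1 and E3 are used) and any
family `𝒲` of boundary values of functions holomorphic on `𝒯ₙ` with Euclidean restriction `𝔖ₙ`
(`IsOSContinuationFamily`), property (d) `IsLocalFamily` holds: the continuations have edge growth by
`hasEdgeGrowth_of_hasDistributionalBoundaryValue`, and then
`IsOSContinuationFamily.isLocalFamily_of_hasEdgeGrowth` (Osterwalder–Schrader I (1973), §4.5: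
symmetric continuation from E3, Bargmann–Hall–Wightman, Jost's theorem). [cite: OsterwalderSchraderCMP1973, §4.5 (p. 97)] -/
theorem IsOSContinuationFamily.isLocalFamily [NeZero d]
    {S : SchwingerFamily (EuclideanSpace ℝ (Fin (d + 1)))} {𝒲 : WightmanFamily d Unit}
    (hOS : S.IsOSFamily) (h𝒲 : IsOSContinuationFamily S 𝒲) : IsLocalFamily 𝒲 := by
  refine IsOSContinuationFamily.isLocalFamily_of_hasEdgeGrowth hOS fun n => ?_
  obtain ⟨𝔚, h𝔚, hbv, hSn⟩ := h𝒲 n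
  exact ⟨𝔚, h𝔚, hbv, hSn, hasEdgeGrowth_of_hasDistributionalBoundaryValue h𝔚 hbv⟩

/-- **Discharge of (A₃, R3) `OS1973_local`** (Osterwalder–Schrader I (1973), §4.5 "Locality"): for
every OS family `S` with E0' and every OS continuation family `𝒲` of `S`, the boundary values have
property (d) `IsLocalFamily`. Proof: `IsOSContinuationFamily.isLocalFamily` (E0' is not used).
[cite: OsterwalderSchraderCMP1973, §4.5 (p. 97)] -/
theorem OS1973_local_holds : OS1973_local :=
  fun _ _ _ hS _ _ h𝒲 => h𝒲.isLocalFamily hS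

end Literature.MathematicalPhysics.QuantumFieldTheory
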